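import Summits.ResolutionOfSingularities.ResolutionOfSingularities.Theorems.FibrewiseClosedPoints.Negative.AlmostDecoration
import Summits.ResolutionOfSingularities.ResolutionOfSingularities.Theorems.SectionAscentGenericLevel
import Literature.AlgebraicGeometry.Resolution.AffineDomainDimension

/-!
# `FibrewiseClosedPoints` — negative lemmas II: no hypothesis is load-bearing; the crux, both
hypothesis-dropped variants and the level family coincide with the route target

Support (negative) lemmas for crux `stmt-ResolutionOfSingularities-15960`
(`Summit.ResolutionOfSingularities.ResolutionOfSingularities.Theses.SectionAscent.FibrewiseClosedPoints`,
route SectionAscent: `∀ p prime, ∀ d, OneShot p d → Almost p (d+1) → OneShot p (d+1)`), filed by the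
standing crux disprover (cdisprove, 2026-08-17). No definition is declared; the `let`-bodies of
`OneShot` / `Almost` are written out inline; no declaration concludes a route decl positively.

LOAD-BEARING ANALYSIS (the disprover's contract is `<Crux>Without<H>` + `_false_without_<H>`; here
the kernel shows that NO such theorem can exist short of refuting the route target):

* `fibrewiseClosedPoints_iff_oneShotAffine` — with `Almost` inhabited outright (landed
  `Theorems.exists_ideal_almost_of_normalization`: the normalisation presented as a one-chart
  blowing up) the crux is EQUIVALENT to the route target `OneShotAffine` (unconditional form of the
  landed `not_fibrewiseClosedPoints_of_not_oneShotAffine`).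
* `fibrewiseClosedPoints_iff_withoutAlmost` — dropping the hypothesis `Almost p (d+1)` gives an
  equivalent statement (the bare inductive step `OneShot p d → OneShot p (d+1)`).
* `fibrewiseClosedPoints_iff_withoutOneShotHyp` — dropping the OTHER hypothesis `OneShot p d`
  ALSO gives an equivalent statement: as a statement the induction hypothesis carries no weight
  either (both variants are the target in disguise), although any proof by induction consumes it.
* `fibrewiseClosedPoints_iff_forall_succ` — the crux is the conjunction of its own conclusions
  `OneShot p (d+1)`, `d ≥ 0` (levels are cumulative and `OneShot p 0` is vacuous). Status of the
  levels in print: `d+1 = 1` fields (landed `oneShotBody_one`), `= 2` curves (blow up the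
  conductor: Liu 2002 Lemma 8.3.47 (a)), `= 3` excellent surfaces (Lipman, Liu 2002 Thm 8.3.44, plus
  negative definiteness of the exceptional curves to present the resolution as ONE blowing up
  cosupported on `Sing`); `d+1 = 4` (threefolds) is OPEN — verbatim Cossart–Piltant, arXiv:1412.0868
  p. 3: "it is not even known if such π can be obtained by blowing up an ideal sheaf 𝓘 ⊆ 𝒪_𝒳 whose
  zero locus is Sing 𝒳, even when 𝒳 is affine" (their Thm 1.1 gives a projective `π`, and Liu 2002
  Thm 8.1.24 presents it as SOME blowing up, with no control of the centre). So the first open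
  instance of the crux is `d = 3`, not `d = 4` as the route header states.
* `crux_instance_zero` — the instance `d = 0` of the crux holds (boundary: no failure below `d = 1`).
* `supportSharpeningBody_of_oneShotAffine`, `oneShotAffine_iff_weak_and_supportSharpening` — for
  the picked line `registered` (`Cruxes/FibrewiseClosedPoints/Lines/birth.lean`): the open stub
  `stub_supportSharpening` ("strong from weak one-shot resolution") is implied by the target and is
  EXACTLY the gap between weak one-shot resolution (some nonzero centre with regular blowing up) and
  the target; in dimension 3 it is therefore Cossart–Piltant's open question above, not a theorem
  (the line card's "known in dim ≤ 3 by CP2019 + Liu 8.1.24" holds in dim ≤ 2 only).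

## Sources
* V. Cossart, O. Piltant, *Resolution of singularities of arithmetical threefolds*, J. Algebra 529
  (2019) 268–535 = arXiv:1412.0868, Thm 1.1 and the remark on p. 3. [CossartPiltant2019]
* Q. Liu, *Algebraic Geometry and Arithmetic Curves* (OUP 2002), Thm 8.1.24, Thm 8.3.44,
  Lemma 8.3.47 (a). [Liu2002]
-/

noncomputable section

set_option linter.dupNamespace false -- mandated namespace of this single-conjunct summit

open CategoryTheory AlgebraicGeometry TopologicalSpace
open Literature.AlgebraicGeometry.Resolution
open Summit.ResolutionOfSingularities.ResolutionOfSingularities.Theses.SectionAscent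

namespace Summit.ResolutionOfSingularities.ResolutionOfSingularities.Theorems.FibrewiseClosedPoints.Negative

/-- **The crux is the target.** `FibrewiseClosedPoints ↔ OneShotAffine`: `←` is instantiation at
`d + 1`; `→` is the route's own induction on `d` (base vacuous: a domain has `ringKrullDim ≥ 0`)
fed with the unconditional `Almost` witnesses of `Theorems.exists_ideal_almost_of_normalization`
(the normalisation as a one-chart blowing up), via the landed
`not_fibrewiseClosedPoints_of_not_oneShotAffine`. [folklore] -/
theorem fibrewiseClosedPoints_iff_oneShotAffine : FibrewiseClosedPoints ↔ OneShotAffine := by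
  constructor
  · intro h
    by_contra hO
    exact not_fibrewiseClosedPoints_of_not_oneShotAffine
      (fun p _ d K _ _ A _ _ _ _ _ =>
        Summit.ResolutionOfSingularities.ResolutionOfSingularities.Theorems.exists_ideal_almost_of_normalization
          K A)
      hO h
  · intro h p hp d _ _
    exact h p hp (d + 1)

/-- **`Almost` is not load-bearing**: the crux with the hypothesis `Almost p (d+1)` DROPPED — the
bare inductive step `OneShot p d → OneShot p (d+1)` of strong affine one-shot resolution — is
equivalent to the crux (because `Almost p (d+1)` holds outright). [folklore] -/
theorem fibrewiseClosedPoints_iff_withoutAlmost :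
    FibrewiseClosedPoints ↔
      ∀ p : ℕ, p.Prime → ∀ d : ℕ,
        (∀ (K : Type) [Field K] [CharP K p] (A : Type) [CommRing A] [IsDomain A] [Algebra K A]
          [Algebra.FiniteType K A], ringKrullDim A < (d : WithBot ℕ∞) → ∃ I : Ideal A, I ≠ ⊥ ∧
            Scheme.IsRegular (affineBlowup I) ∧
            ∀ 𝔭 : PrimeSpectrum A, I ≤ 𝔭.asIdeal ↔ ¬ IsRegularLocalRing (Localization.AtPrime 𝔭.asIdeal)) →
        ∀ (K : Type) [Field K] [CharP K p] (A : Type) [CommRing A] [IsDomain A] [Algebra K A]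
          [Algebra.FiniteType K A], ringKrullDim A < ((d + 1 : ℕ) : WithBot ℕ∞) → ∃ I : Ideal A, I ≠ ⊥ ∧
            Scheme.IsRegular (affineBlowup I) ∧
            ∀ 𝔭 : PrimeSpectrum A, I ≤ 𝔭.asIdeal ↔ ¬ IsRegularLocalRing (Localization.AtPrime 𝔭.asIdeal) := by
  constructor
  · intro h p hp d hd
    exact h p hp d hd (fun K _ _ A _ _ _ _ _ =>
      Summit.ResolutionOfSingularities.ResolutionOfSingularities.Theorems.exists_ideal_almost_of_normalization
        K A)
  · intro h p hp d hd _
    exact h p hp d hd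

/-- **`OneShot p d` is not load-bearing either (as a statement)**: the crux with the induction
hypothesis `OneShot p d` DROPPED — `Almost p (d+1) → OneShot p (d+1)` — is again equivalent to the
crux: both are the target `OneShotAffine` (`fibrewiseClosedPoints_iff_oneShotAffine`). Hence no
`_false_without_` theorem exists for either hypothesis unless `OneShotAffine` itself is refuted.
[folklore] -/
theorem fibrewiseClosedPoints_iff_withoutOneShotHyp :
    FibrewiseClosedPoints ↔
      ∀ p : ℕ, p.Prime → ∀ d : ℕ,
        (∀ (K : Type) [Field K] [CharP K p] (A : Type) [CommRing A] [IsDomain A] [Algebra K A]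
          [Algebra.FiniteType K A], ringKrullDim A < ((d + 1 : ℕ) : WithBot ℕ∞) → ∃ I : Ideal A, I ≠ ⊥ ∧
            (∀ 𝔭 : PrimeSpectrum A, ¬ I ≤ 𝔭.asIdeal →
              IsRegularLocalRing (Localization.AtPrime 𝔭.asIdeal)) ∧
            (∀ y : affineBlowup I, IsIntegrallyClosed ((affineBlowup I).presheaf.stalk y)) ∧
            ∀ y : affineBlowup I, (∃ z : affineBlowup I, z ≠ y ∧ y ⤳ z ∧
              (affineBlowup.π I).base z = (affineBlowup.π I).base y) →
                IsRegularLocalRing ((affineBlowup I).presheaf.stalk y)) →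
        ∀ (K : Type) [Field K] [CharP K p] (A : Type) [CommRing A] [IsDomain A] [Algebra K A]
          [Algebra.FiniteType K A], ringKrullDim A < ((d + 1 : ℕ) : WithBot ℕ∞) → ∃ I : Ideal A, I ≠ ⊥ ∧
            Scheme.IsRegular (affineBlowup I) ∧
            ∀ 𝔭 : PrimeSpectrum A, I ≤ 𝔭.asIdeal ↔ ¬ IsRegularLocalRing (Localization.AtPrime 𝔭.asIdeal) := by
  constructor
  · intro h p hp d _
    exact (fibrewiseClosedPoints_iff_oneShotAffine.mp h) p hp (d + 1)
  · intro h p hp d _ hA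
    exact h p hp d hA

/-- **The crux is the family of its own conclusions.** `FibrewiseClosedPoints ↔ ∀ p prime, ∀ d,
OneShot p (d+1)`: the levels are cumulative (`dim < d+1 → …` contains `dim < d → …`) and
`OneShot p 0` is vacuous, so quantifying the conclusion over `d` already gives the target. Status
in print of `OneShot p (d+1)`: `d+1 ≤ 3` known (fields; curves — conductor blow-up, Liu 2002
8.3.47 (a); excellent surfaces — Lipman, Liu 2002 8.3.44, presented as one `Sing`-cosupported
blowing up via negative definiteness of the exceptional curves); `d+1 = 4` is OPEN (Cossart–Piltant,
arXiv:1412.0868 p. 3, verbatim: not known whether their projective `π` is the blowing up of an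
ideal sheaf with zero locus `Sing 𝒳`, even for affine `𝒳`). [cite: CossartPiltant2019, Thm 1.1 and p. 3] -/
theorem fibrewiseClosedPoints_iff_forall_succ :
    FibrewiseClosedPoints ↔
      ∀ p : ℕ, p.Prime → ∀ d : ℕ,
        ∀ (K : Type) [Field K] [CharP K p] (A : Type) [CommRing A] [IsDomain A] [Algebra K A]
          [Algebra.FiniteType K A], ringKrullDim A < ((d + 1 : ℕ) : WithBot ℕ∞) → ∃ I : Ideal A, I ≠ ⊥ ∧
            Scheme.IsRegular (affineBlowup I) ∧
            ∀ 𝔭 : PrimeSpectrum A, I ≤ 𝔭.asIdeal ↔ ¬ IsRegularLocalRing (Localization.AtPrime 𝔭.asIdeal) := by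
  rw [fibrewiseClosedPoints_iff_oneShotAffine]
  constructor
  · intro h p hp d
    exact h p hp (d + 1)
  · intro h p hp d
    cases d with
    | zero =>
        intro K _ _ A _ _ _ _ hdim
        exfalso
        have h0 : (0 : WithBot ℕ∞) ≤ ringKrullDim A := ringKrullDim_nonneg_of_nontrivial
        exact absurd hdim (not_lt.mpr (by simpa using h0))
    | succ d => exact h p hp d

/-- **Boundary: the instance `d = 0` of the crux holds** (`OneShot p 0 → Almost p 1 → OneShot p 1`:
the conclusion is the landed `oneShotBody_one` — dimension-`0` domains are fields), so a failure
of the crux needs `d ≥ 1`; by the previous lemma and the status list the first instance not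
settled in print is `d = 3`. [folklore] -/
theorem crux_instance_zero (p : ℕ) :
    (∀ (K : Type) [Field K] [CharP K p] (A : Type) [CommRing A] [IsDomain A] [Algebra K A]
      [Algebra.FiniteType K A], ringKrullDim A < ((0 : ℕ) : WithBot ℕ∞) → ∃ I : Ideal A, I ≠ ⊥ ∧
        Scheme.IsRegular (affineBlowup I) ∧
        ∀ 𝔭 : PrimeSpectrum A, I ≤ 𝔭.asIdeal ↔ ¬ IsRegularLocalRing (Localization.AtPrime 𝔭.asIdeal)) →
    (∀ (K : Type) [Field K] [CharP K p] (A : Type) [CommRing A] [IsDomain A] [Algebra K A]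
      [Algebra.FiniteType K A], ringKrullDim A < ((0 + 1 : ℕ) : WithBot ℕ∞) → ∃ I : Ideal A, I ≠ ⊥ ∧
        (∀ 𝔭 : PrimeSpectrum A, ¬ I ≤ 𝔭.asIdeal →
          IsRegularLocalRing (Localization.AtPrime 𝔭.asIdeal)) ∧
        (∀ y : affineBlowup I, IsIntegrallyClosed ((affineBlowup I).presheaf.stalk y)) ∧
        ∀ y : affineBlowup I, (∃ z : affineBlowup I, z ≠ y ∧ y ⤳ z ∧
          (affineBlowup.π I).base z = (affineBlowup.π I).base y) →
            IsRegularLocalRing ((affineBlowup I).presheaf.stalk y)) →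
    ∀ (K : Type) [Field K] [CharP K p] (A : Type) [CommRing A] [IsDomain A] [Algebra K A]
      [Algebra.FiniteType K A], ringKrullDim A < ((0 + 1 : ℕ) : WithBot ℕ∞) → ∃ I : Ideal A, I ≠ ⊥ ∧
        Scheme.IsRegular (affineBlowup I) ∧
        ∀ 𝔭 : PrimeSpectrum A, I ≤ 𝔭.asIdeal ↔ ¬ IsRegularLocalRing (Localization.AtPrime 𝔭.asIdeal) := by
  intro _ _ K _ _ A _ _ _ _ hdim
  exact oneShotBody_one A hdim

/-- **Line `registered`: the stub `stub_supportSharpening` is implied by the target.** Its body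
("an integral affine variety over a field of characteristic `p` admitting SOME nonzero ideal with
regular blowing up admits one with regular blowing up AND zero set exactly the non-regular locus")
follows from `OneShotAffine` without using the weak witness: a domain of finite type over a field
has finite Krull dimension `n` (tree `exists_ringKrullDim_eq_and_trdeg_eq`), and the target at level
`n + 1` applies. So any refutation of the stub refutes the target and the crux. [folklore] -/
theorem supportSharpeningBody_of_oneShotAffine :
    OneShotAffine →
      ∀ (p : ℕ), p.Prime → ∀ (K : Type) [Field K] [CharP K p] (A : Type) [CommRing A] [IsDomain A]
        [Algebra K A] [Algebra.FiniteType K A] (I : Ideal A), I ≠ ⊥ →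
        Scheme.IsRegular (affineBlowup I) →
        ∃ I' : Ideal A, I' ≠ ⊥ ∧ Scheme.IsRegular (affineBlowup I') ∧
          ∀ 𝔭 : PrimeSpectrum A, I' ≤ 𝔭.asIdeal ↔ ¬ IsRegularLocalRing (Localization.AtPrime 𝔭.asIdeal) := by
  intro h p hp K _ _ A _ _ _ _ _ _ _
  obtain ⟨n, hn, -⟩ := exists_ringKrullDim_eq_and_trdeg_eq K A
  refine h p hp (n + 1) K A ?_
  rw [hn]
  exact_mod_cast Nat.lt_succ_self n

/-- **The stub `stub_supportSharpening` is EXACTLY the gap between weak and strong one-shot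
resolution**: the target `OneShotAffine` holds iff (i) every integral affine variety over a field of
characteristic `p` has SOME nonzero ideal with regular blowing up (weak one-shot resolution, every
level) and (ii) the body of `stub_supportSharpening`. In dimension `3` (i) is available in print
(Cossart–Piltant Thm 1.1 + Liu 2002 Thm 8.1.24: a projective resolution of an affine threefold is
some blowing up) while the target is Cossart–Piltant's open question (p. 3) — so in dimension `3`
the stub is that open question, not a theorem; it is known in dimension `≤ 2` only.
[cite: CossartPiltant2019, Thm 1.1 and p. 3] -/
theorem oneShotAffine_iff_weak_and_supportSharpening :
    OneShotAffine ↔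
      (∀ (p : ℕ), p.Prime → ∀ (K : Type) [Field K] [CharP K p] (A : Type) [CommRing A] [IsDomain A]
        [Algebra K A] [Algebra.FiniteType K A], ∃ I : Ideal A, I ≠ ⊥ ∧ Scheme.IsRegular (affineBlowup I)) ∧
      (∀ (p : ℕ), p.Prime → ∀ (K : Type) [Field K] [CharP K p] (A : Type) [CommRing A] [IsDomain A]
        [Algebra K A] [Algebra.FiniteType K A] (I : Ideal A), I ≠ ⊥ →
        Scheme.IsRegular (affineBlowup I) →
        ∃ I' : Ideal A, I' ≠ ⊥ ∧ Scheme.IsRegular (affineBlowup I') ∧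
          ∀ 𝔭 : PrimeSpectrum A, I' ≤ 𝔭.asIdeal ↔ ¬ IsRegularLocalRing (Localization.AtPrime 𝔭.asIdeal)) := by
  constructor
  · intro h
    refine ⟨fun p hp K _ _ A _ _ _ _ => ?_, supportSharpeningBody_of_oneShotAffine h⟩
    obtain ⟨n, hn, -⟩ := exists_ringKrullDim_eq_and_trdeg_eq K A
    obtain ⟨I, hI, hreg, -⟩ := h p hp (n + 1) K A (by rw [hn]; exact_mod_cast Nat.lt_succ_self n)
    exact ⟨I, hI, hreg⟩
  · rintro ⟨hweak, hsharp⟩ p hp d K _ _ A _ _ _ _ _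
    obtain ⟨I, hI, hreg⟩ := hweak p hp K A
    exact hsharp p hp K A I hI hreg

end Summit.ResolutionOfSingularities.ResolutionOfSingularities.Theorems.FibrewiseClosedPoints.Negative

end
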